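import Mathlib
import Summits.BirchSwinnertonDyer.BirchSwinnertonDyer.Theorems.ResidualThetaTransportAtTwoSignedMuSeedAtTwoPlusNonsquareDescentHilbertNinety
import HarnessLib

/-!
# Non-square descent — ISOTYPIC INDEX BOOKKEEPING: `[M : C] = [eM : eC]·[(1−e)M : (1−e)C]` for an idempotent `e`, and «`i(A) = e₁B`, `#B = #A·#(1−e₁)B`»
# for an inclusion/norm pair with `N∘i = n`, `i∘N = n·e₁` (`n` a unit) — the `χ`-bookkeeping of stub S2's index-theorem step
# «Oukhaba along `M_n` and `K_n` … gives `ord₂ #A(M_n)^χ ≤ ord₂ #B'_n + O(1)`» (line `nonsquare-descent`) — seed crux `SignedMuSeedAtTwoPlus`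
# stmt-BirchSwinnertonDyer-21438 (parent Kμ⁺ `SignedMuVanishingAtTwoPlus` stmt-BirchSwinnertonDyer-20689, route ResidualThetaTransportAtTwo),
# line card `Cruxes/SignedMuSeedAtTwoPlus/Lines/nonsquare-descent.md`

Cell `bsd-wall`, width seat `bsd-wall-rtt-p4-w2` g19 (`--supports`, closes nothing).  THEOREMS ONLY; BSD is not proved by this and nothing
arithmetic is asserted: module algebra over a commutative ring `R` with an idempotent scalar `e` (e.g. `e₁ = ⅓ Σ_{δ∈Δ} δ ∈ ℤ₂[Δ]`,
`Δ = Gal(M/K)` of order `3`, `3 ∈ ℤ₂ˣ`; `1 − e₁ = e_χ + e_{χ̄}` cuts the `χ`-isotypic part).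

Stub S2 compares `2`-parts of class numbers and unit indices along `M_n` and `K_n`: `#A(M_n) = #A(K_n) · #A_n^χ` and
`[𝓔(M_n) : 𝓒(M_n)] = [𝓔(K_n) : 𝓒(K_n)] · [𝓔_n^χ : 𝓒_n^χ]` (on `ℤ₂`-parts), because `3 = [M_n : K_n]` is invertible in `ℤ₂`: the inclusion
`i` and the norm `N` satisfy `N∘i = 3`, `i∘N = Σ_δ δ = 3e₁`.  The module algebra of this:

* §1 `inf_smul_top_eq_smul` (`C ∩ eM = eC`), `map_lsmul_smul_top`, `isCompl_smul_top` (`M = eM ⊕ (1−e)M`), **`natCard_eq_mul_of_idempotent`**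
  (`#M = #eM · #(1−e)M`), **`natCard_quotient_eq_mul_of_idempotent`** (`#(M/C) = (eM : eC)·((1−e)M : (1−e)C)` — `Nat.card`, unconditional).
* §2 inclusion/norm pairs: `injective_of_norm_comp` (`N∘i = n•`, `n` a unit ⟹ `i` injective), **`range_eq_smul_top_of_norm`** (`i∘N = (n e)•` too ⟹
  `range i = eB`), `natCard_eq_natCard_smul_top` (`#A = #eB`), **`natCard_eq_mul_of_norm`** (`#B = #A · #(1−e)B` — «`#A(M_n)₂ = #A(K_n)₂ · #A_n^{χ}`»).

[folklore]
-/

set_option autoImplicit false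
-- the Theorems namespace of this sub repeats the summit name by design (D-0017 nested layout)
set_option linter.dupNamespace false

open scoped Pointwise
open Literature.Algebra.Homology

namespace Summit.BirchSwinnertonDyer.BirchSwinnertonDyer.Theorems.SignedMuAtTwo.NonsquareDescent

universe u v w

variable {R : Type u} [CommRing R] {M : Type v} [AddCommGroup M] [Module R M]

/-! ## §1 `M = eM ⊕ (1 − e)M` and the index splitting -/

section Idempotent

/-- `C ∩ eM = eC` for an idempotent `e` (`x = ey ∈ C ⟹ x = ex ∈ eC`). [folklore] -/
theorem inf_smul_top_eq_smul {e : R} (he : IsIdempotentElem e) (C : Submodule R M) :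
    C ⊓ e • (⊤ : Submodule R M) = e • C := by
  ext x
  rw [Submodule.mem_inf, Submodule.mem_smul_pointwise_iff_exists, Submodule.mem_smul_pointwise_iff_exists]
  constructor
  · rintro ⟨hxC, y, -, rfl⟩
    refine ⟨e • y, hxC, ?_⟩
    rw [smul_smul, he.eq]
  · rintro ⟨c, hc, rfl⟩
    exact ⟨C.smul_mem e hc, c, Submodule.mem_top, rfl⟩

/-- `f(aS) = a f(S)` for a linear map. [folklore] -/
theorem map_lsmul_eq_smul_map {M₂ : Type w} [AddCommGroup M₂] [Module R M₂] (f : M →ₗ[R] M₂) (a : R) (S : Submodule R M) :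
    (a • S).map f = a • S.map f := by
  ext y
  rw [Submodule.mem_map, Submodule.mem_smul_pointwise_iff_exists]
  constructor
  · rintro ⟨x, hx, rfl⟩
    rw [Submodule.mem_smul_pointwise_iff_exists] at hx
    obtain ⟨s, hs, rfl⟩ := hx
    exact ⟨f s, Submodule.mem_map_of_mem hs, (map_smul f a s).symm⟩
  · rintro ⟨z, hz, rfl⟩
    rw [Submodule.mem_map] at hz
    obtain ⟨s, hs, rfl⟩ := hz
    exact ⟨a • s, Submodule.smul_mem_pointwise_smul _ _ _ hs, map_smul f a s⟩

/-- **`M = eM ⊕ (1−e)M`** for an idempotent `e`. [folklore] -/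
theorem isCompl_smul_top {e : R} (he : IsIdempotentElem e) :
    IsCompl (e • (⊤ : Submodule R M)) ((1 - e) • (⊤ : Submodule R M)) := by
  refine IsCompl.of_eq ?_ ?_
  · rw [Submodule.eq_bot_iff]
    intro x hx
    obtain ⟨hx1, hx2⟩ := Submodule.mem_inf.1 hx
    rw [Submodule.mem_smul_pointwise_iff_exists] at hx1 hx2
    obtain ⟨y, -, rfl⟩ := hx1
    obtain ⟨z, -, hz⟩ := hx2
    have h1 : e • (e • y) = e • y := by rw [smul_smul, he.eq]
    rw [← hz, smul_smul, mul_sub, mul_one, he.eq, sub_self, zero_smul] at h1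
    rw [← hz, ← h1]
  · rw [Submodule.eq_top_iff']
    intro x
    rw [Submodule.mem_sup]
    refine ⟨e • x, Submodule.smul_mem_pointwise_smul _ _ _ Submodule.mem_top, (1 - e) • x,
      Submodule.smul_mem_pointwise_smul _ _ _ Submodule.mem_top, ?_⟩
    rw [← add_smul, add_sub_cancel, one_smul]

/-- **`#M = #eM · #(1−e)M`** (`Nat.card`, unconditional). [folklore] -/
theorem natCard_eq_mul_of_idempotent {e : R} (he : IsIdempotentElem e) :
    Nat.card M = Nat.card ↥(e • (⊤ : Submodule R M)) * Nat.card ↥((1 - e) • (⊤ : Submodule R M)) := by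
  rw [← Nat.card_prod]
  exact (Nat.card_congr (Submodule.prodEquivOfIsCompl _ _ (isCompl_smul_top (M := M) he)).toEquiv).symm

/-- **`#(M/C) = (eM : eC) · ((1−e)M : (1−e)C)`** — «`[𝓔(M_n) : 𝓒(M_n)]₂ = [𝓔(K_n) : 𝓒(K_n)]₂ · [𝓔_n^χ : 𝓒_n^χ]`» (`Nat.card`, unconditional; any
submodule `C`, automatically `e`-stable). [folklore] -/
theorem natCard_quotient_eq_mul_of_idempotent {e : R} (he : IsIdempotentElem e) (C : Submodule R M) :
    Nat.card (M ⧸ C) = Herbrand.index (e • (⊤ : Submodule R M)) (e • C) *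
      Herbrand.index ((1 - e) • (⊤ : Submodule R M)) ((1 - e) • C) := by
  have he' : IsIdempotentElem (1 - e) := he.one_sub
  rw [natCard_eq_mul_of_idempotent (M := M ⧸ C) he]
  have key : ∀ a : R, IsIdempotentElem a →
      Nat.card ↥(a • (⊤ : Submodule R (M ⧸ C))) = Herbrand.index (a • (⊤ : Submodule R M)) (a • C) := by
    intro a ha
    rw [← Submodule.range_mkQ C, ← Submodule.map_top, ← map_lsmul_eq_smul_map, card_map_eq_index_ker, Submodule.ker_mkQ,
      ← Herbrand.index_inf_right, inf_smul_top_eq_smul ha]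
  rw [key e he, key (1 - e) he']

end Idempotent

/-! ## §2 Inclusion/norm pairs: `N∘i = n`, `i∘N = n·e` -/

section NormPair

variable {A : Type w} [AddCommGroup A] [Module R A] (i : A →ₗ[R] M) (Nm : M →ₗ[R] A) {n e : R}

/-- `N∘i = n•` with `n` a unit makes the inclusion `i` injective («`Cl(K_n)[2^∞] ↪ Cl(M_n)[2^∞]`, `3 ∤ 2`»). [folklore] -/
theorem injective_of_norm_comp (hn : IsUnit n) (hNi : ∀ a : A, Nm (i a) = n • a) : Function.Injective i := by
  intro a b hab
  have h : n • a = n • b := by rw [← hNi, ← hNi, hab]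
  obtain ⟨w, rfl⟩ := hn
  simpa only [smul_smul, Units.inv_mul, one_smul] using congrArg (fun x => ((w⁻¹ : Rˣ) : R) • x) h

/-- **`range i = eM`** when `N∘i = n•` and `i∘N = (n e)•` with `n` a unit («`Cl(K_n)[2^∞] = Cl(M_n)[2^∞]^{Δ} = e₁·Cl(M_n)[2^∞]`», `i∘N = Σ_δ δ = 3e₁`).
[folklore] -/
theorem range_eq_smul_top_of_norm (hn : IsUnit n) (hNi : ∀ a : A, Nm (i a) = n • a) (hiN : ∀ x : M, i (Nm x) = (n * e) • x) :
    LinearMap.range i = e • (⊤ : Submodule R M) := by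
  obtain ⟨w, rfl⟩ := hn
  ext x
  rw [LinearMap.mem_range, Submodule.mem_smul_pointwise_iff_exists]
  constructor
  · rintro ⟨a, rfl⟩
    refine ⟨i a, Submodule.mem_top, ?_⟩
    -- `(n e) • i a = i (N (i a)) = i (n a) = n • i a`, cancel the unit `n`
    have h1 : ((w : R) * e) • i a = (w : R) • i a := by rw [← hiN (i a), hNi, map_smul]
    have h2 := congrArg (fun x => ((w⁻¹ : Rˣ) : R) • x) h1
    simp only [smul_smul, ← mul_assoc, Units.inv_mul, one_mul, one_smul] at h2
    exact h2
  · rintro ⟨y, -, rfl⟩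
    refine ⟨((w⁻¹ : Rˣ) : R) • Nm y, ?_⟩
    rw [map_smul, hiN, smul_smul, ← mul_assoc, Units.inv_mul, one_mul]

/-- Hence `#A = #eM`. [folklore] -/
theorem natCard_eq_natCard_smul_top (hn : IsUnit n) (hNi : ∀ a : A, Nm (i a) = n • a)
    (hiN : ∀ x : M, i (Nm x) = (n * e) • x) :
    Nat.card A = Nat.card ↥(e • (⊤ : Submodule R M)) := by
  rw [← range_eq_smul_top_of_norm i Nm hn hNi hiN]
  exact Nat.card_congr (LinearEquiv.ofInjective i (injective_of_norm_comp i Nm hn hNi)).toEquiv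

/-- **`#M = #A · #(1−e)M`** for an inclusion/norm pair with `N∘i = n•`, `i∘N = (n e)•`, `n` a unit, `e` idempotent
(«`#A(M_n)[2^∞] = #A(K_n)[2^∞] · #A_n^{χ}`», the `χ`-bookkeeping of the index-theorem step of stub S2). [folklore] -/
theorem natCard_eq_mul_of_norm (he : IsIdempotentElem e) (hn : IsUnit n) (hNi : ∀ a : A, Nm (i a) = n • a)
    (hiN : ∀ x : M, i (Nm x) = (n * e) • x) :
    Nat.card M = Nat.card A * Nat.card ↥((1 - e) • (⊤ : Submodule R M)) := by
  rw [natCard_eq_natCard_smul_top i Nm hn hNi hiN]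
  exact natCard_eq_mul_of_idempotent he

end NormPair

end Summit.BirchSwinnertonDyer.BirchSwinnertonDyer.Theorems.SignedMuAtTwo.NonsquareDescent
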